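import Mathlib.Combinatorics.SetFamily.HarrisKleitman
import Mathlib.Tactic.Ring
import Mathlib.Tactic.Linarith

/-!
# The strict Harris–Kleitman inequality at a common coordinate

Dossier proofs/MINE1-theoremS.md, Addendum 57 suppl. 4 (v). For a lower set `D` and an upper set
`A` of `Finset α`, Harris–Kleitman gives `2 ^ |α| · |D ∩ A| ≤ |D| · |A|`. If both families DEPEND
on the same coordinate `e` — `D` strictly loses members when `e` is forced in
(`|memberSubfamily e D| < |nonMemberSubfamily e D|`) and `A` strictly gains
(`|nonMemberSubfamily e A| < |memberSubfamily e A|`) — the inequality is STRICT: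
`card_inter_mul_lt_of_depends`. Proof: split on `e`; Harris–Kleitman on the two halves
(transported to `2^α` by the doublings `doubleErase`, `doubleInsert`) gives
`2^|α| |D ∩ A| ≤ 2(d₀a₀ + d₁a₁) = |D||A| − (d₀ − d₁)(a₁ − a₀) < |D||A|`.
The two doublings: `doubleErase e G = {s : s.erase e ∈ G}` (`= 2 · nonMemberSubfamily`) and
`doubleInsert e G = {s : insert e s ∈ G}` (`= 2 · memberSubfamily`), both monotone when `G` is.
-/

namespace PercRepro.MSTight

open Finset

variable {α : Type*} [DecidableEq α] [Fintype α] {e : α} {G H : Finset (Finset α)}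

section Doublings

/-- The sets whose `e`-free part lies in `G`. -/
def doubleErase (e : α) (G : Finset (Finset α)) : Finset (Finset α) :=
  univ.filter fun s => s.erase e ∈ G

/-- The sets whose `e`-completion lies in `G`. -/
def doubleInsert (e : α) (G : Finset (Finset α)) : Finset (Finset α) :=
  univ.filter fun s => insert e s ∈ G

/-- Membership in `doubleErase`. -/
theorem mem_doubleErase {s : Finset α} : s ∈ doubleErase e G ↔ s.erase e ∈ G := by
  simp [doubleErase]

/-- Membership in `doubleInsert`. -/
theorem mem_doubleInsert {s : Finset α} : s ∈ doubleInsert e G ↔ insert e s ∈ G := by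
  simp [doubleInsert]

/-- `doubleErase` of a lower set is a lower set. -/
theorem isLowerSet_doubleErase (h : IsLowerSet (G : Set (Finset α))) :
    IsLowerSet (doubleErase e G : Set (Finset α)) := by
  intro t s hst ht
  rw [mem_coe, mem_doubleErase] at ht ⊢
  exact h (erase_subset_erase e hst) ht

/-- `doubleInsert` of a lower set is a lower set. -/
theorem isLowerSet_doubleInsert (h : IsLowerSet (G : Set (Finset α))) :
    IsLowerSet (doubleInsert e G : Set (Finset α)) := by
  intro t s hst ht
  rw [mem_coe, mem_doubleInsert] at ht ⊢
  exact h (insert_subset_insert e hst) ht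

/-- `doubleErase` of an upper set is an upper set. -/
theorem isUpperSet_doubleErase (h : IsUpperSet (G : Set (Finset α))) :
    IsUpperSet (doubleErase e G : Set (Finset α)) := by
  intro s t hst hs
  rw [mem_coe, mem_doubleErase] at hs ⊢
  exact h (erase_subset_erase e hst) hs

/-- `doubleInsert` of an upper set is an upper set. -/
theorem isUpperSet_doubleInsert (h : IsUpperSet (G : Set (Finset α))) :
    IsUpperSet (doubleInsert e G : Set (Finset α)) := by
  intro s t hst hs
  rw [mem_coe, mem_doubleInsert] at hs ⊢
  exact h (insert_subset_insert e hst) hs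

/-- `doubleErase` commutes with intersections. -/
theorem doubleErase_inter : doubleErase e (G ∩ H) = doubleErase e G ∩ doubleErase e H := by
  ext s
  simp only [mem_doubleErase, mem_inter]

/-- `doubleInsert` commutes with intersections. -/
theorem doubleInsert_inter : doubleInsert e (G ∩ H) = doubleInsert e G ∩ doubleInsert e H := by
  ext s
  simp only [mem_doubleInsert, mem_inter]

/-- `doubleErase e G` is the `e`-free members of `G` together with their `e`-completions. -/
theorem doubleErase_eq :
    doubleErase e G = G.nonMemberSubfamily e ∪ (G.nonMemberSubfamily e).image (insert e) := by
  ext s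
  simp only [mem_doubleErase, mem_union, mem_nonMemberSubfamily, mem_image]
  constructor
  · intro hs
    by_cases hes : e ∈ s
    · right
      exact ⟨s.erase e, ⟨hs, notMem_erase e s⟩, insert_erase hes⟩
    · left
      rw [erase_eq_of_notMem hes] at hs
      exact ⟨hs, hes⟩
  · rintro (⟨hs, hes⟩ | ⟨t, ⟨ht, het⟩, rfl⟩)
    · rw [erase_eq_of_notMem hes]
      exact hs
    · rw [erase_insert het]
      exact ht

/-- `doubleInsert e G` is the `e`-subfamily of `G` together with its `e`-completions. -/
theorem doubleInsert_eq :
    doubleInsert e G = G.memberSubfamily e ∪ (G.memberSubfamily e).image (insert e) := by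
  ext s
  simp only [mem_doubleInsert, mem_union, mem_memberSubfamily, mem_image]
  constructor
  · intro hs
    by_cases hes : e ∈ s
    · right
      refine ⟨s.erase e, ⟨?_, notMem_erase e s⟩, insert_erase hes⟩
      rw [insert_erase hes]
      rw [insert_eq_of_mem hes] at hs
      exact hs
    · left
      exact ⟨hs, hes⟩
  · rintro (⟨hs, -⟩ | ⟨t, ⟨ht, -⟩, rfl⟩)
    · exact hs
    · rw [insert_idem]
      exact ht

omit [Fintype α] in
/-- The cardinality of the union of an `e`-free family with its `e`-completion. -/
theorem card_union_image_insert {G' : Finset (Finset α)} (hG' : ∀ s ∈ G', e ∉ s) :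
    (G' ∪ G'.image (insert e)).card = 2 * G'.card := by
  have hinj : Set.InjOn (insert e) (G' : Set (Finset α)) := by
    intro s hs t ht hst
    have hes : e ∉ s := hG' s (mem_coe.1 hs)
    have het : e ∉ t := hG' t (mem_coe.1 ht)
    have hst' : insert e s = insert e t := hst
    rw [← erase_insert hes, hst', erase_insert het]
  have hdisj : Disjoint G' (G'.image (insert e)) := by
    rw [disjoint_left]
    intro s hs hs'
    obtain ⟨t, -, rfl⟩ := mem_image.1 hs'
    exact hG' _ hs (mem_insert_self e t)
  rw [card_union_of_disjoint hdisj, card_image_of_injOn hinj]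
  omega

/-- `|doubleErase e G| = 2 |nonMemberSubfamily e G|`. -/
theorem card_doubleErase : (doubleErase e G).card = 2 * (G.nonMemberSubfamily e).card := by
  rw [doubleErase_eq]
  exact card_union_image_insert fun s hs => (mem_nonMemberSubfamily.1 hs).2

/-- `|doubleInsert e G| = 2 |memberSubfamily e G|`. -/
theorem card_doubleInsert : (doubleInsert e G).card = 2 * (G.memberSubfamily e).card := by
  rw [doubleInsert_eq]
  exact card_union_image_insert fun s hs => (mem_memberSubfamily.1 hs).2

end Doublings

section Strict

omit [Fintype α] in
/-- For an upper set, the `e`-free members embed into the `e`-subfamily. -/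
theorem IsUpperSet.nonMemberSubfamily_subset_memberSubfamily
    (h : IsUpperSet (G : Set (Finset α))) : G.nonMemberSubfamily e ⊆ G.memberSubfamily e := by
  intro s hs
  obtain ⟨hs, hes⟩ := mem_nonMemberSubfamily.1 hs
  exact mem_memberSubfamily.2 ⟨h (subset_insert e s) hs, hes⟩

/-- **The strict Harris–Kleitman inequality.** If the lower set `D` and the upper set `A` both
depend on the coordinate `e`, then `2 ^ |α| · |D ∩ A| < |D| · |A|`. -/
theorem card_inter_mul_lt_of_depends {D A : Finset (Finset α)}
    (hD : IsLowerSet (D : Set (Finset α))) (hA : IsUpperSet (A : Set (Finset α))) (e : α)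
    (hDe : (D.memberSubfamily e).card < (D.nonMemberSubfamily e).card)
    (hAe : (A.nonMemberSubfamily e).card < (A.memberSubfamily e).card) :
    2 ^ Fintype.card α * (D ∩ A).card < D.card * A.card := by
  have h0 := (isLowerSet_doubleErase (e := e) hD).card_inter_le_finset
    (isUpperSet_doubleErase (e := e) hA)
  have h1 := (isLowerSet_doubleInsert (e := e) hD).card_inter_le_finset
    (isUpperSet_doubleInsert (e := e) hA)
  rw [← doubleErase_inter, card_doubleErase, card_doubleErase, card_doubleErase] at h0
  rw [← doubleInsert_inter, card_doubleInsert, card_doubleInsert, card_doubleInsert] at h1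
  have hDA := card_memberSubfamily_add_card_nonMemberSubfamily e (D ∩ A)
  have hD' := card_memberSubfamily_add_card_nonMemberSubfamily e D
  have hA' := card_memberSubfamily_add_card_nonMemberSubfamily e A
  obtain ⟨k, hk⟩ := Nat.exists_eq_add_of_lt hDe
  obtain ⟨l, hl⟩ := Nat.exists_eq_add_of_lt hAe
  rw [← hDA, ← hD', ← hA', hk, hl]
  rw [hk] at h0
  rw [hl] at h1
  nlinarith [h0, h1]

end Strict

end PercRepro.MSTight
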